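import Mathlib
import HarnessLib
import Summits.ResolutionOfSingularities.ResolutionOfSingularities.Theorems.WildQuotientsWildQuotientResolutionS1aQhAwayDatum

/-!
# S1a — R4e: the RING-LEVEL DATA of the root `(x₀ : m+2, x₁ : 1, x₂ : m+1; sh = m+1)` of a local graph tail OVER `L = k[x][1/hh]`

[OURS · L1 W4.5c · lead-1 g16; plan-1 RULING R-F15p ★ R4e-rational `graphTail_killsIn_two` — per critical point, the inputs of ✓`exists_moveAtlas_of_nodes` and of the
killed charts, read in the localised node ring `L = k[x][1/hh]` (✓`…S1aQhAwayDatum`, ✓`…S1aQhAbsCover`): the 3-COVER `(x₀^{n₀}, N(x₁)^{n₁}, N(t)^{n₂})` at the common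
degree `dbar = D·(m+2)(m+1)p`, its `σ`-fixedness, the cover elements in `R^w`, `hrad`, and the residual sections killing the charts of `x₀` and of the tail norm]
— NOT statements of the manuscript; counted 0; AI-level work, weaker than expert review. Crux stmt-ResolutionOfSingularities-17941 `CyclicQuotientFourfolds`, line
`s1a-logminvertex` v13 (`stub_reachLowerInFX`).

* `graphRoot_tail_eq` — `t̂ = u₂′ − u₁′^{m+1}·w(x₁)` in `R^w(L)`; `graphRoot_iterate_tail_sub_mem` — every `σ_Rʲ t̂ − u₂′ ∈ (u₀′, u₁′)`;
* ★★ `graphRoot_ringData` — the package (cover `y`, `hy`, `hσy`, values, cover elements, `t̂ ∣ c₂`, `hrad`, residual sections with their degree-0 / `𝔞`-memberships).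
-/

set_option linter.dupNamespace false

noncomputable section

open Literature.AlgebraicGeometry.Resolution
open scoped LaurentPolynomial
open MvPolynomial
open Summit.ResolutionOfSingularities.ResolutionOfSingularities.Theorems.WildQuotientResolution.S1
open Summit.ResolutionOfSingularities.ResolutionOfSingularities.Theorems.WildQuotientResolution.S1.CoarseChart
open Summit.ResolutionOfSingularities.ResolutionOfSingularities.Theorems.WildQuotientResolution.S1.NodeAway
open Summit.ResolutionOfSingularities.ResolutionOfSingularities.Theorems.WildQuotientResolution.S1.CentreAway
open Summit.ResolutionOfSingularities.ResolutionOfSingularities.Theorems.WildQuotientResolution.S1.BlowupCharts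
open Summit.ResolutionOfSingularities.ResolutionOfSingularities.Theorems.WildQuotientResolution.S1.GameFrame.GModel

namespace Summit.ResolutionOfSingularities.ResolutionOfSingularities.Theorems.WildQuotientResolution.S1.KillCert.QhAway

variable {k : Type} [Field k] (σ : MvPolynomial (Fin 4) k ≃+* MvPolynomial (Fin 4) k) (hC : ∀ a : k, σ (C a) = C a)
  (h0 : σ (X 0) = X 0) (h1 : σ (X 1) = X 1 + X 0) (h2 : σ (X 2) = X 2) (m : ℕ) (wl : Polynomial k)
  (h3 : σ (X 3) = X 3 + (X 2 - X 1 ^ (m + 1) * Polynomial.aeval (X 1 : MvPolynomial (Fin 4) k) wl : MvPolynomial (Fin 4) k))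
  (hh : MvPolynomial (Fin 4) k) (hσh : σ hh = hh)
  {p : ℕ} (hp : 0 < p) (hσpL : ∀ y : (Localization.Away hh), (⇑(sigmaAway σ hσh))^[p] y = y)
  (hσJ : ∀ n : ℕ, ((weightedFiltration (fun i => algebraMap (MvPolynomial (Fin 4) k) (Localization.Away hh) (X ((![0, 1, 2] : Fin 3 → Fin 4) i))) (![m + 2, 1, m + 1] : Fin 3 → ℕ)).ideal n).map ((sigmaAway σ hσh) : (Localization.Away hh) →+* (Localization.Away hh)) ≤ (weightedFiltration (fun i => algebraMap (MvPolynomial (Fin 4) k) (Localization.Away hh) (X ((![0, 1, 2] : Fin 3 → Fin 4) i))) (![m + 2, 1, m + 1] : Fin 3 → ℕ)).ideal n)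
  (ht : (algebraMap (MvPolynomial (Fin 4) k) (Localization.Away hh) (X 2 - X 1 ^ (m + 1) * Polynomial.aeval (X 1 : MvPolynomial (Fin 4) k) wl : MvPolynomial (Fin 4) k)) ∈ (weightedFiltration (fun i => algebraMap (MvPolynomial (Fin 4) k) (Localization.Away hh) (X ((![0, 1, 2] : Fin 3 → Fin 4) i))) (![m + 2, 1, m + 1] : Fin 3 → ℕ)).ideal (m + 1))

/-- **The tail element of a local graph tail**: `t̂ = u₂′ − u₁′^{m+1}·(w(x₁)/1)` in `R^w(L)`. -/
theorem graphRoot_tail_eq : (⟨_, C_mul_T_mem_cobordantAlgebra _ _ ht⟩ : ↥(cobordantAlgebra (fun i => algebraMap (MvPolynomial (Fin 4) k) (Localization.Away hh) (X ((![0, 1, 2] : Fin 3 → Fin 4) i))) (![m + 2, 1, m + 1] : Fin 3 → ℕ))) = cobordantAlgebra.u' (fun i => algebraMap (MvPolynomial (Fin 4) k) (Localization.Away hh) (X ((![0, 1, 2] : Fin 3 → Fin 4) i))) (![m + 2, 1, m + 1] : Fin 3 → ℕ) 2 -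
    cobordantAlgebra.u' (fun i => algebraMap (MvPolynomial (Fin 4) k) (Localization.Away hh) (X ((![0, 1, 2] : Fin 3 → Fin 4) i))) (![m + 2, 1, m + 1] : Fin 3 → ℕ) 1 ^ (m + 1) * algebraMap (Localization.Away hh) ↥(cobordantAlgebra (fun i => algebraMap (MvPolynomial (Fin 4) k) (Localization.Away hh) (X ((![0, 1, 2] : Fin 3 → Fin 4) i))) (![m + 2, 1, m + 1] : Fin 3 → ℕ)) (algebraMap (MvPolynomial (Fin 4) k) (Localization.Away hh) (Polynomial.aeval (X 1 : MvPolynomial (Fin 4) k) wl)) := by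
  refine Subtype.ext ?_
  rw [AddSubgroupClass.coe_sub, MulMemClass.coe_mul, SubmonoidClass.coe_pow, cobordantAlgebra.coe_u', cobordantAlgebra.coe_u', cobordantAlgebra.coe_algebraMap]
  change LaurentPolynomial.C (algebraMap (MvPolynomial (Fin 4) k) (Localization.Away hh) (X 2 - X 1 ^ (m + 1) * Polynomial.aeval (X 1 : MvPolynomial (Fin 4) k) wl : MvPolynomial (Fin 4) k)) * LaurentPolynomial.T (((m + 1 : ℕ)) : ℤ) =
    LaurentPolynomial.C (algebraMap (MvPolynomial (Fin 4) k) (Localization.Away hh) (X 2)) * LaurentPolynomial.T (((m + 1 : ℕ)) : ℤ) -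
      (LaurentPolynomial.C (algebraMap (MvPolynomial (Fin 4) k) (Localization.Away hh) (X 1)) * LaurentPolynomial.T (((1 : ℕ)) : ℤ)) ^ (m + 1) * LaurentPolynomial.C (algebraMap (MvPolynomial (Fin 4) k) (Localization.Away hh) (Polynomial.aeval (X 1 : MvPolynomial (Fin 4) k) wl))
  rw [map_sub, map_mul, map_pow, map_sub, map_mul, map_pow, mul_pow, ← map_pow, LaurentPolynomial.T_pow]
  push_cast
  ring

include h0 h1 h2 h3 in
/-- **Every iterate `σ_Rʲ t̂` is congruent to `u₂′` modulo `(u₀′, u₁′)`** (so the tail-norm cover element satisfies the hypothesis `hg` of ✓`qha_hrad`). -/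
theorem graphRoot_iterate_tail_sub_mem (j : ℕ) :
    ((sigmaR (sigmaAway σ hσh) (fun i => algebraMap (MvPolynomial (Fin 4) k) (Localization.Away hh) (X ((![0, 1, 2] : Fin 3 → Fin 4) i))) (![m + 2, 1, m + 1] : Fin 3 → ℕ) hσJ hp hσpL))^[j] (⟨_, C_mul_T_mem_cobordantAlgebra _ _ ht⟩ : ↥(cobordantAlgebra (fun i => algebraMap (MvPolynomial (Fin 4) k) (Localization.Away hh) (X ((![0, 1, 2] : Fin 3 → Fin 4) i))) (![m + 2, 1, m + 1] : Fin 3 → ℕ))) - cobordantAlgebra.u' (fun i => algebraMap (MvPolynomial (Fin 4) k) (Localization.Away hh) (X ((![0, 1, 2] : Fin 3 → Fin 4) i))) (![m + 2, 1, m + 1] : Fin 3 → ℕ) 2 ∈ Ideal.span ({cobordantAlgebra.u' (fun i => algebraMap (MvPolynomial (Fin 4) k) (Localization.Away hh) (X ((![0, 1, 2] : Fin 3 → Fin 4) i))) (![m + 2, 1, m + 1] : Fin 3 → ℕ) 0, cobordantAlgebra.u' (fun i => algebraMap (MvPolynomial (Fin 4) k) (Localization.Away hh) (X ((![0, 1,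 2] : Fin 3 → Fin 4) i))) (![m + 2, 1, m + 1] : Fin 3 → ℕ) 1} : Set ↥(cobordantAlgebra (fun i => algebraMap (MvPolynomial (Fin 4) k) (Localization.Away hh) (X ((![0, 1, 2] : Fin 3 → Fin 4) i))) (![m + 2, 1, m + 1] : Fin 3 → ℕ))) := by
  obtain ⟨r0, r1, r2, -⟩ := qhl_rows σ h0 h1 h2 (X 2 - X 1 ^ (m + 1) * Polynomial.aeval (X 1 : MvPolynomial (Fin 4) k) wl : MvPolynomial (Fin 4) k) h3 hh hσh
  have hu2 : (sigmaR (sigmaAway σ hσh) (fun i => algebraMap (MvPolynomial (Fin 4) k) (Localization.Away hh) (X ((![0, 1, 2] : Fin 3 → Fin 4) i))) (![m + 2, 1, m + 1] : Fin 3 → ℕ) hσJ hp hσpL) (cobordantAlgebra.u' (fun i => algebraMap (MvPolynomial (Fin 4) k) (Localization.Away hh) (X ((![0, 1, 2] : Fin 3 → Fin 4) i))) (![m + 2, 1, m + 1] : Fin 3 → ℕ) 2) = cobordantAlgebra.u' (fun i => algebraMap (MvPolynomial (Fin 4) k) (Localization.Away hh) (X ((![0, 1, 2] : Fin 3 → Fin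 4) i))) (![m + 2, 1, m + 1] : Fin 3 → ℕ) 2 := QhAbs.qha_sigmaR_u'_two (sigmaAway σ hσh) (fun i => algebraMap (MvPolynomial (Fin 4) k) (Localization.Away hh) (X ((![0, 1, 2] : Fin 3 → Fin 4) i))) (![m + 2, 1, m + 1] : Fin 3 → ℕ) r2 hp hσpL hσJ
  have hu0 : (sigmaR (sigmaAway σ hσh) (fun i => algebraMap (MvPolynomial (Fin 4) k) (Localization.Away hh) (X ((![0, 1, 2] : Fin 3 → Fin 4) i))) (![m + 2, 1, m + 1] : Fin 3 → ℕ) hσJ hp hσpL) (cobordantAlgebra.u' (fun i => algebraMap (MvPolynomial (Fin 4) k) (Localization.Away hh) (X ((![0, 1, 2] : Fin 3 → Fin 4) i))) (![m + 2, 1, m + 1] : Fin 3 → ℕ) 0) = cobordantAlgebra.u' (fun i => algebraMap (MvPolynomial (Fin 4) k) (Localization.Away hh) (X ((![0, 1, 2] : Fin 3 → Fin 4) i))) (![m + 2, 1, m + 1] : Fin 3 → ℕ) 0 := QhAbs.qha_sigmaR_u'_zero (sigmaAway σ hσh) (fun i => algebraMap (MvPolynomial (Fin 4) k) (Localization.Away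 hh) (X ((![0, 1, 2] : Fin 3 → Fin 4) i))) (![m + 2, 1, m + 1] : Fin 3 → ℕ) r0 hp hσpL hσJ
  have hu1 : (sigmaR (sigmaAway σ hσh) (fun i => algebraMap (MvPolynomial (Fin 4) k) (Localization.Away hh) (X ((![0, 1, 2] : Fin 3 → Fin 4) i))) (![m + 2, 1, m + 1] : Fin 3 → ℕ) hσJ hp hσpL) (cobordantAlgebra.u' (fun i => algebraMap (MvPolynomial (Fin 4) k) (Localization.Away hh) (X ((![0, 1, 2] : Fin 3 → Fin 4) i))) (![m + 2, 1, m + 1] : Fin 3 → ℕ) 1) = cobordantAlgebra.u' (fun i => algebraMap (MvPolynomial (Fin 4) k) (Localization.Away hh) (X ((![0, 1, 2] : Fin 3 → Fin 4) i))) (![m + 2, 1, m + 1] : Fin 3 → ℕ) 1 + cobordantAlgebra.s (fun i => algebraMap (MvPolynomial (Fin 4) k) (Localization.Away hh) (X ((![0, 1, 2] : Fin 3 → Fin 4) i))) (![m + 2, 1, m + 1] : Fin 3 → ℕ) ^ (m + 1) * cobordantAlgebra.u' (fun i => algebraMap (MvPolynomial (Fin 4) k) (Localization.Away hh) (X ((![0,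 1, 2] : Fin 3 → Fin 4) i))) (![m + 2, 1, m + 1] : Fin 3 → ℕ) 0 := by
    have h := QhAbs.qha_sigmaR_u'_one_sub (sigmaAway σ hσh) (fun i => algebraMap (MvPolynomial (Fin 4) k) (Localization.Away hh) (X ((![0, 1, 2] : Fin 3 → Fin 4) i))) (![m + 2, 1, m + 1] : Fin 3 → ℕ) (m + 1) r1 (show (![m + 2, 1, m + 1] : Fin 3 → ℕ) 0 = (![m + 2, 1, m + 1] : Fin 3 → ℕ) 1 + (m + 1) by change m + 2 = 1 + (m + 1); ring) hp hσpL hσJ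
    rw [sub_eq_iff_eq_add] at h
    rw [h]
    ring
  -- the span `(u₀′, u₁′)` is `σ_R`-stable
  have hstab : ∀ z ∈ Ideal.span ({cobordantAlgebra.u' (fun i => algebraMap (MvPolynomial (Fin 4) k) (Localization.Away hh) (X ((![0, 1, 2] : Fin 3 → Fin 4) i))) (![m + 2, 1, m + 1] : Fin 3 → ℕ) 0, cobordantAlgebra.u' (fun i => algebraMap (MvPolynomial (Fin 4) k) (Localization.Away hh) (X ((![0, 1, 2] : Fin 3 → Fin 4) i))) (![m + 2, 1, m + 1] : Fin 3 → ℕ) 1} : Set ↥(cobordantAlgebra (fun i => algebraMap (MvPolynomial (Fin 4) k) (Localization.Away hh) (X ((![0, 1, 2] : Fin 3 → Fin 4) i))) (![m + 2, 1, m + 1] : Fin 3 → ℕ))),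
      (sigmaR (sigmaAway σ hσh) (fun i => algebraMap (MvPolynomial (Fin 4) k) (Localization.Away hh) (X ((![0, 1, 2] : Fin 3 → Fin 4) i))) (![m + 2, 1, m + 1] : Fin 3 → ℕ) hσJ hp hσpL) z ∈ Ideal.span ({cobordantAlgebra.u' (fun i => algebraMap (MvPolynomial (Fin 4) k) (Localization.Away hh) (X ((![0, 1, 2] : Fin 3 → Fin 4) i))) (![m + 2, 1, m + 1] : Fin 3 → ℕ) 0, cobordantAlgebra.u' (fun i => algebraMap (MvPolynomial (Fin 4) k) (Localization.Away hh) (X ((![0, 1, 2] : Fin 3 → Fin 4) i))) (![m + 2, 1, m + 1] : Fin 3 → ℕ) 1} : Set ↥(cobordantAlgebra (fun i => algebraMap (MvPolynomial (Fin 4) k) (Localization.Away hh) (X ((![0, 1, 2] : Fin 3 → Fin 4) i))) (![m + 2, 1, m + 1] : Fin 3 → ℕ))) := by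
    intro z hz
    have hle : (Ideal.span ({cobordantAlgebra.u' (fun i => algebraMap (MvPolynomial (Fin 4) k) (Localization.Away hh) (X ((![0, 1, 2] : Fin 3 → Fin 4) i))) (![m + 2, 1, m + 1] : Fin 3 → ℕ) 0, cobordantAlgebra.u' (fun i => algebraMap (MvPolynomial (Fin 4) k) (Localization.Away hh) (X ((![0, 1, 2] : Fin 3 → Fin 4) i))) (![m + 2, 1, m + 1] : Fin 3 → ℕ) 1} : Set ↥(cobordantAlgebra (fun i => algebraMap (MvPolynomial (Fin 4) k) (Localization.Away hh) (X ((![0, 1, 2] : Fin 3 → Fin 4) i))) (![m + 2, 1, m + 1] : Fin 3 → ℕ)))).map ((sigmaR (sigmaAway σ hσh) (fun i => algebraMap (MvPolynomial (Fin 4) k) (Localization.Away hh) (X ((![0, 1, 2] : Fin 3 → Fin 4) i))) (![m + 2, 1, m + 1] : Fin 3 → ℕ) hσJ hp hσpL) : ↥(cobordantAlgebra (fun i => algebraMap (MvPolynomial (Fin 4) k) (Localization.Away hh) (X ((![0, 1, 2] : Fin 3 → Fin 4) i))) (![m + 2, 1, m + 1] : Fin 3 → ℕ)) →+* ↥(cobordantAlgebra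 (fun i => algebraMap (MvPolynomial (Fin 4) k) (Localization.Away hh) (X ((![0, 1, 2] : Fin 3 → Fin 4) i))) (![m + 2, 1, m + 1] : Fin 3 → ℕ))) ≤
        Ideal.span ({cobordantAlgebra.u' (fun i => algebraMap (MvPolynomial (Fin 4) k) (Localization.Away hh) (X ((![0, 1, 2] : Fin 3 → Fin 4) i))) (![m + 2, 1, m + 1] : Fin 3 → ℕ) 0, cobordantAlgebra.u' (fun i => algebraMap (MvPolynomial (Fin 4) k) (Localization.Away hh) (X ((![0, 1, 2] : Fin 3 → Fin 4) i))) (![m + 2, 1, m + 1] : Fin 3 → ℕ) 1} : Set ↥(cobordantAlgebra (fun i => algebraMap (MvPolynomial (Fin 4) k) (Localization.Away hh) (X ((![0, 1, 2] : Fin 3 → Fin 4) i))) (![m + 2, 1, m + 1] : Fin 3 → ℕ))) := by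
      rw [Ideal.map_span, Ideal.span_le]
      rintro _ ⟨g, hg, rfl⟩
      simp only [Set.mem_insert_iff, Set.mem_singleton_iff] at hg
      rcases hg with rfl | rfl
      · rw [RingHom.coe_coe, hu0]; exact Ideal.subset_span (by simp)
      · rw [RingHom.coe_coe, hu1]
        exact add_mem (Ideal.subset_span (by simp)) (Ideal.mul_mem_left _ _ (Ideal.subset_span (by simp)))
    exact hle (Ideal.mem_map_of_mem _ hz)
  induction j with
  | zero =>
    rw [Function.iterate_zero_apply, graphRoot_tail_eq m wl hh ht, sub_sub_cancel_left, neg_mem_iff]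
    exact Ideal.mul_mem_right _ _ (Ideal.pow_mem_of_mem _ (Ideal.subset_span (by simp)) _ (Nat.succ_pos m))
  | succ j ih =>
    rw [Function.iterate_succ_apply']
    have h := hstab _ ih
    rwa [map_sub, hu2] at h

section Data

variable {mg : ℕ} (mo : Fin mg → ℕ) (𝒜 : (Π j : Fin mg, ZMod (mo j)) → AddSubgroup (Localization.Away hh)) [GradedRing 𝒜] (h𝒜 : ∀ x : (Localization.Away hh), x ∈ 𝒜 0)
  (hσp : ∀ a : MvPolynomial (Fin 4) k, (⇑σ)^[p] a = a) (hh0 : hh ≠ 0)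

set_option maxHeartbeats 4000000 in
include h0 h1 h2 h3 hσp hh0 h𝒜 in
/-- ★★ **THE RING-LEVEL DATA OF THE GRAPH ROOT OVER `L`** at the common degree `dbar = D·(m+2)(m+1)p`: the 3-cover `y = (x₀^{(m+1)pD}, N(x₁)^{(m+2)(m+1)D},
N(t)^{(m+2)D})`, its trace membership and `σ`-fixedness, the cover elements `c₀ = u₀′^{n₀}`, `c₁ = (∏ᵢ(u₁′ + i·u₀′s^{m+1}))^{n₁}`, `t̂ ∣ c₂`, `hrad`, and on EVERY chart `j`
the two residual sections `u₀′^{n₀}/cⱼ`, `c₂/cⱼ` (degree 0, in `𝔞·R_{cⱼ}`, `𝔞 = (aug σ_R : s^{m+1})`). [OURS · L1 W4.5c · R4e; NOT a statement of the manuscript] -/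
theorem graphRoot_ringData [Fact p.Prime] [CharP k p] (D : ℕ) (hD : 0 < D) :
    ∃ (y : Fin 3 → ↥(𝒜 0)) (hy : ∀ j, y j ∈ (traceFiltration 𝒜 (fun i => algebraMap (MvPolynomial (Fin 4) k) (Localization.Away hh) (X ((![0, 1, 2] : Fin 3 → Fin 4) i))) (![m + 2, 1, m + 1] : Fin 3 → ℕ)).ideal (D * ((m + 2) * (m + 1) * p))),
      (∀ j, (sigmaAway σ hσh) (y j : (Localization.Away hh)) = y j) ∧
      ((y 0 : (Localization.Away hh)) = (fun i => algebraMap (MvPolynomial (Fin 4) k) (Localization.Away hh) (X ((![0, 1, 2] : Fin 3 → Fin 4) i))) 0 ^ ((m + 1) * p * D)) ∧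
      ((y 1 : (Localization.Away hh)) = (∏ i : ZMod p, ((fun i => algebraMap (MvPolynomial (Fin 4) k) (Localization.Away hh) (X ((![0, 1, 2] : Fin 3 → Fin 4) i))) 1 + (i.val : (Localization.Away hh)) * (fun i => algebraMap (MvPolynomial (Fin 4) k) (Localization.Away hh) (X ((![0, 1, 2] : Fin 3 → Fin 4) i))) 0)) ^ ((m + 2) * (m + 1) * D)) ∧
      ((y 2 : (Localization.Away hh)) = (∏ j : ZMod p, (⇑(sigmaAway σ hσh))^[j.val] (algebraMap (MvPolynomial (Fin 4) k) (Localization.Away hh) (X 2 - X 1 ^ (m + 1) * Polynomial.aeval (X 1 : MvPolynomial (Fin 4) k) wl : MvPolynomial (Fin 4) k))) ^ ((m + 2) * D)) ∧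
      coverElement 𝒜 (fun i => algebraMap (MvPolynomial (Fin 4) k) (Localization.Away hh) (X ((![0, 1, 2] : Fin 3 → Fin 4) i))) (![m + 2, 1, m + 1] : Fin 3 → ℕ) (D * ((m + 2) * (m + 1) * p)) (y 0) (hy 0) = cobordantAlgebra.u' (fun i => algebraMap (MvPolynomial (Fin 4) k) (Localization.Away hh) (X ((![0, 1, 2] : Fin 3 → Fin 4) i))) (![m + 2, 1, m + 1] : Fin 3 → ℕ) 0 ^ ((m + 1) * p * D) ∧
      coverElement 𝒜 (fun i => algebraMap (MvPolynomial (Fin 4) k) (Localization.Away hh) (X ((![0, 1, 2] : Fin 3 → Fin 4) i))) (![m + 2, 1, m + 1] : Fin 3 → ℕ) (D * ((m + 2) * (m + 1) * p)) (y 1) (hy 1) = (∏ i : ZMod p, (cobordantAlgebra.u' (fun i => algebraMap (MvPolynomial (Fin 4) k) (Localization.Away hh) (X ((![0, 1, 2] : Fin 3 → Fin 4) i))) (![m + 2, 1, m + 1] : Fin 3 → ℕ) 1 + algebraMap (Localization.Away hh) ↥(cobordantAlgebra (fun i => algebraMap (MvPolynomial (Fin 4) k) (Localization.Away hh) (X ((![0,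 1, 2] : Fin 3 → Fin 4) i))) (![m + 2, 1, m + 1] : Fin 3 → ℕ)) (i.val : (Localization.Away hh)) * (cobordantAlgebra.u' (fun i => algebraMap (MvPolynomial (Fin 4) k) (Localization.Away hh) (X ((![0, 1, 2] : Fin 3 → Fin 4) i))) (![m + 2, 1, m + 1] : Fin 3 → ℕ) 0 * cobordantAlgebra.s (fun i => algebraMap (MvPolynomial (Fin 4) k) (Localization.Away hh) (X ((![0, 1, 2] : Fin 3 → Fin 4) i))) (![m + 2, 1, m + 1] : Fin 3 → ℕ) ^ (m + 1)))) ^ ((m + 2) * (m + 1) * D) ∧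
      ((⟨_, C_mul_T_mem_cobordantAlgebra _ _ ht⟩ : ↥(cobordantAlgebra (fun i => algebraMap (MvPolynomial (Fin 4) k) (Localization.Away hh) (X ((![0, 1, 2] : Fin 3 → Fin 4) i))) (![m + 2, 1, m + 1] : Fin 3 → ℕ))) ∣ coverElement 𝒜 (fun i => algebraMap (MvPolynomial (Fin 4) k) (Localization.Away hh) (X ((![0, 1, 2] : Fin 3 → Fin 4) i))) (![m + 2, 1, m + 1] : Fin 3 → ℕ) (D * ((m + 2) * (m + 1) * p)) (y 2) (hy 2)) ∧
      (∀ l : Fin 3, cobordantAlgebra.u' (fun i => algebraMap (MvPolynomial (Fin 4) k) (Localization.Away hh) (X ((![0, 1, 2] : Fin 3 → Fin 4) i))) (![m + 2, 1, m + 1] : Fin 3 → ℕ) l ∈ (Ideal.span (Set.range fun j => coverElement 𝒜 (fun i => algebraMap (MvPolynomial (Fin 4) k) (Localization.Away hh) (X ((![0, 1, 2] : Fin 3 → Fin 4) i))) (![m + 2, 1, m + 1] : Fin 3 → ℕ) (D * ((m + 2) * (m + 1) * p)) (y j) (hy j))).radical) ∧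
      (∀ j : Fin 3,
        (algebraMap ↥(cobordantAlgebra (fun i => algebraMap (MvPolynomial (Fin 4) k) (Localization.Away hh) (X ((![0, 1, 2] : Fin 3 → Fin 4) i))) (![m + 2, 1, m + 1] : Fin 3 → ℕ)) (ChartRing 𝒜 (fun i => algebraMap (MvPolynomial (Fin 4) k) (Localization.Away hh) (X ((![0, 1, 2] : Fin 3 → Fin 4) i))) (![m + 2, 1, m + 1] : Fin 3 → ℕ) (D * ((m + 2) * (m + 1) * p)) (y j) (hy j)) (cobordantAlgebra.u' (fun i => algebraMap (MvPolynomial (Fin 4) k) (Localization.Away hh) (X ((![0, 1, 2] : Fin 3 → Fin 4) i))) (![m + 2, 1, m + 1] : Fin 3 → ℕ) 0 ^ ((m + 1) * p * D)) * IsLocalization.Away.invSelf (coverElement 𝒜 (fun i => algebraMap (MvPolynomial (Fin 4) k) (Localization.Away hh) (X ((![0, 1, 2] : Fin 3 → Fin 4) i))) (![m + 2, 1, m + 1] : Fin 3 → ℕ) (D * ((m + 2) * (m + 1) * p)) (y j) (hy j)) ∈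
            chartNodeGrading mo 𝒜 (fun i => algebraMap (MvPolynomial (Fin 4) k) (Localization.Away hh) (X ((![0, 1, 2] : Fin 3 → Fin 4) i))) (![m + 2, 1, m + 1] : Fin 3 → ℕ) (fun _ => h𝒜 _) (D * ((m + 2) * (m + 1) * p)) (y j) (hy j) 0 ∧
          algebraMap ↥(cobordantAlgebra (fun i => algebraMap (MvPolynomial (Fin 4) k) (Localization.Away hh) (X ((![0, 1, 2] : Fin 3 → Fin 4) i))) (![m + 2, 1, m + 1] : Fin 3 → ℕ)) (ChartRing 𝒜 (fun i => algebraMap (MvPolynomial (Fin 4) k) (Localization.Away hh) (X ((![0, 1, 2] : Fin 3 → Fin 4) i))) (![m + 2, 1, m + 1] : Fin 3 → ℕ) (D * ((m + 2) * (m + 1) * p)) (y j) (hy j)) (cobordantAlgebra.u' (fun i => algebraMap (MvPolynomial (Fin 4) k) (Localization.Away hh) (X ((![0, 1, 2] : Fin 3 → Fin 4) i))) (![m + 2, 1, m + 1] : Fin 3 → ℕ) 0 ^ ((m + 1) * p * D)) * IsLocalization.Away.invSelf (coverElement 𝒜 (fun i => algebraMap (MvPolynomial (Fin 4) k) (Localization.Away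 hh) (X ((![0, 1, 2] : Fin 3 → Fin 4) i))) (![m + 2, 1, m + 1] : Fin 3 → ℕ) (D * ((m + 2) * (m + 1) * p)) (y j) (hy j)) ∈ (((augmentationIdeal (sigmaR (sigmaAway σ hσh) (fun i => algebraMap (MvPolynomial (Fin 4) k) (Localization.Away hh) (X ((![0, 1, 2] : Fin 3 → Fin 4) i))) (![m + 2, 1, m + 1] : Fin 3 → ℕ) hσJ hp hσpL)).colon (Ideal.span {cobordantAlgebra.s (fun i => algebraMap (MvPolynomial (Fin 4) k) (Localization.Away hh) (X ((![0, 1, 2] : Fin 3 → Fin 4) i))) (![m + 2, 1, m + 1] : Fin 3 → ℕ) ^ (m + 1)}))).map (algebraMap ↥(cobordantAlgebra (fun i => algebraMap (MvPolynomial (Fin 4) k) (Localization.Away hh) (X ((![0, 1, 2] : Fin 3 → Fin 4) i))) (![m + 2, 1, m + 1] : Fin 3 → ℕ)) (ChartRing 𝒜 (fun i => algebraMap (MvPolynomial (Fin 4) k) (Localization.Away hh) (X ((![0, 1, 2] : Fin 3 → Fin 4) i))) (![m + 2, 1, m + 1] : Fin 3 → ℕ) (D * ((m + 2) * (m + 1)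 * p)) (y j) (hy j)))) ∧
        (algebraMap ↥(cobordantAlgebra (fun i => algebraMap (MvPolynomial (Fin 4) k) (Localization.Away hh) (X ((![0, 1, 2] : Fin 3 → Fin 4) i))) (![m + 2, 1, m + 1] : Fin 3 → ℕ)) (ChartRing 𝒜 (fun i => algebraMap (MvPolynomial (Fin 4) k) (Localization.Away hh) (X ((![0, 1, 2] : Fin 3 → Fin 4) i))) (![m + 2, 1, m + 1] : Fin 3 → ℕ) (D * ((m + 2) * (m + 1) * p)) (y j) (hy j)) (coverElement 𝒜 (fun i => algebraMap (MvPolynomial (Fin 4) k) (Localization.Away hh) (X ((![0, 1, 2] : Fin 3 → Fin 4) i))) (![m + 2, 1, m + 1] : Fin 3 → ℕ) (D * ((m + 2) * (m + 1) * p)) (y 2) (hy 2)) * IsLocalization.Away.invSelf (coverElement 𝒜 (fun i => algebraMap (MvPolynomial (Fin 4) k) (Localization.Away hh) (X ((![0, 1, 2] : Fin 3 → Fin 4) i))) (![m + 2, 1, m + 1] : Fin 3 → ℕ) (D * ((m + 2) * (m + 1) * p)) (y j) (hy j)) ∈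
            chartNodeGrading mo 𝒜 (fun i => algebraMap (MvPolynomial (Fin 4) k) (Localization.Away hh) (X ((![0, 1, 2] : Fin 3 → Fin 4) i))) (![m + 2, 1, m + 1] : Fin 3 → ℕ) (fun _ => h𝒜 _) (D * ((m + 2) * (m + 1) * p)) (y j) (hy j) 0 ∧
          algebraMap ↥(cobordantAlgebra (fun i => algebraMap (MvPolynomial (Fin 4) k) (Localization.Away hh) (X ((![0, 1, 2] : Fin 3 → Fin 4) i))) (![m + 2, 1, m + 1] : Fin 3 → ℕ)) (ChartRing 𝒜 (fun i => algebraMap (MvPolynomial (Fin 4) k) (Localization.Away hh) (X ((![0, 1, 2] : Fin 3 → Fin 4) i))) (![m + 2, 1, m + 1] : Fin 3 → ℕ) (D * ((m + 2) * (m + 1) * p)) (y j) (hy j)) (coverElement 𝒜 (fun i => algebraMap (MvPolynomial (Fin 4) k) (Localization.Away hh) (X ((![0, 1, 2] : Fin 3 → Fin 4) i))) (![m + 2, 1, m + 1] : Fin 3 → ℕ) (D * ((m + 2) * (m + 1) * p)) (y 2) (hy 2)) * IsLocalization.Away.invSelf (coverElement 𝒜 (fun i => algebraMap (MvPolynomial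 (Fin 4) k) (Localization.Away hh) (X ((![0, 1, 2] : Fin 3 → Fin 4) i))) (![m + 2, 1, m + 1] : Fin 3 → ℕ) (D * ((m + 2) * (m + 1) * p)) (y j) (hy j)) ∈ (((augmentationIdeal (sigmaR (sigmaAway σ hσh) (fun i => algebraMap (MvPolynomial (Fin 4) k) (Localization.Away hh) (X ((![0, 1, 2] : Fin 3 → Fin 4) i))) (![m + 2, 1, m + 1] : Fin 3 → ℕ) hσJ hp hσpL)).colon (Ideal.span {cobordantAlgebra.s (fun i => algebraMap (MvPolynomial (Fin 4) k) (Localization.Away hh) (X ((![0, 1, 2] : Fin 3 → Fin 4) i))) (![m + 2, 1, m + 1] : Fin 3 → ℕ) ^ (m + 1)}))).map (algebraMap ↥(cobordantAlgebra (fun i => algebraMap (MvPolynomial (Fin 4) k) (Localization.Away hh) (X ((![0, 1, 2] : Fin 3 → Fin 4) i))) (![m + 2, 1, m + 1] : Fin 3 → ℕ)) (ChartRing 𝒜 (fun i => algebraMap (MvPolynomial (Fin 4) k) (Localization.Away hh) (X ((![0, 1, 2] : Fin 3 → Fin 4) i))) (![m + 2, 1, m + 1] : Fin 3 → ℕ)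 (D * ((m + 2) * (m + 1) * p)) (y j) (hy j))))) := by
  classical
  haveI : NeZero p := ⟨(Fact.out : p.Prime).ne_zero⟩
  have hp1 : p ≠ 1 := (Fact.out : p.Prime).ne_one
  haveI : CharP (Localization.Away hh) p := qhl_charP hh hh0
  obtain ⟨r0, r1, r2, r3⟩ := qhl_rows σ h0 h1 h2 (X 2 - X 1 ^ (m + 1) * Polynomial.aeval (X 1 : MvPolynomial (Fin 4) k) wl : MvPolynomial (Fin 4) k) h3 hh hσh
  have hw0 : (![m + 2, 1, m + 1] : Fin 3 → ℕ) 0 = (![m + 2, 1, m + 1] : Fin 3 → ℕ) 1 + (m + 1) := by change m + 2 = 1 + (m + 1); ring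
  have hd₀ : D * ((m + 2) * (m + 1) * p) = (![m + 2, 1, m + 1] : Fin 3 → ℕ) 0 * ((m + 1) * p * D) := by change D * ((m + 2) * (m + 1) * p) = (m + 2) * ((m + 1) * p * D); ring
  have hd₁ : D * ((m + 2) * (m + 1) * p) = p * (![m + 2, 1, m + 1] : Fin 3 → ℕ) 1 * ((m + 2) * (m + 1) * D) := by change D * ((m + 2) * (m + 1) * p) = p * 1 * ((m + 2) * (m + 1) * D); ring
  have hd₂ : D * ((m + 2) * (m + 1) * p) = (m + 1) * p * ((m + 2) * D) := by ring
  have hn₀ : 0 < (m + 1) * p * D := Nat.mul_pos (Nat.mul_pos (Nat.succ_pos m) hp) hD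
  have hn₁ : 0 < (m + 2) * (m + 1) * D := Nat.mul_pos (Nat.mul_pos (Nat.succ_pos _) (Nat.succ_pos m)) hD
  have hn₂ : 0 < (m + 2) * D := Nat.mul_pos (Nat.succ_pos _) hD
  -- the cover, kept opaque
  obtain ⟨cov, hcov⟩ : ∃ cov : Fin 3 → (Localization.Away hh), cov = ![(fun i => algebraMap (MvPolynomial (Fin 4) k) (Localization.Away hh) (X ((![0, 1, 2] : Fin 3 → Fin 4) i))) 0 ^ ((m + 1) * p * D), (∏ i : ZMod p, ((fun i => algebraMap (MvPolynomial (Fin 4) k) (Localization.Away hh) (X ((![0, 1, 2] : Fin 3 → Fin 4) i))) 1 + (i.val : (Localization.Away hh)) * (fun i => algebraMap (MvPolynomial (Fin 4) k) (Localization.Away hh) (X ((![0, 1, 2] : Fin 3 → Fin 4) i))) 0)) ^ ((m + 2) * (m + 1) * D),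
      (∏ j : ZMod p, (⇑(sigmaAway σ hσh))^[j.val] (algebraMap (MvPolynomial (Fin 4) k) (Localization.Away hh) (X 2 - X 1 ^ (m + 1) * Polynomial.aeval (X 1 : MvPolynomial (Fin 4) k) wl : MvPolynomial (Fin 4) k))) ^ ((m + 2) * D)] := ⟨_, rfl⟩
  have hcov0 : cov 0 = (fun i => algebraMap (MvPolynomial (Fin 4) k) (Localization.Away hh) (X ((![0, 1, 2] : Fin 3 → Fin 4) i))) 0 ^ ((m + 1) * p * D) := by rw [hcov]; rfl
  have hcov1 : cov 1 = (∏ i : ZMod p, ((fun i => algebraMap (MvPolynomial (Fin 4) k) (Localization.Away hh) (X ((![0, 1, 2] : Fin 3 → Fin 4) i))) 1 + (i.val : (Localization.Away hh)) * (fun i => algebraMap (MvPolynomial (Fin 4) k) (Localization.Away hh) (X ((![0, 1, 2] : Fin 3 → Fin 4) i))) 0)) ^ ((m + 2) * (m + 1) * D) := by rw [hcov]; rfl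
  have hcov2 : cov 2 = (∏ j : ZMod p, (⇑(sigmaAway σ hσh))^[j.val] (algebraMap (MvPolynomial (Fin 4) k) (Localization.Away hh) (X 2 - X 1 ^ (m + 1) * Polynomial.aeval (X 1 : MvPolynomial (Fin 4) k) wl : MvPolynomial (Fin 4) k))) ^ ((m + 2) * D) := by rw [hcov]; rfl
  let y : Fin 3 → ↥(𝒜 0) := fun j => ⟨cov j, h𝒜 _⟩
  have hyval : ∀ j, (y j : (Localization.Away hh)) = cov j := fun _ => rfl
  have hy : ∀ j, y j ∈ (traceFiltration 𝒜 (fun i => algebraMap (MvPolynomial (Fin 4) k) (Localization.Away hh) (X ((![0, 1, 2] : Fin 3 → Fin 4) i))) (![m + 2, 1, m + 1] : Fin 3 → ℕ)).ideal (D * ((m + 2) * (m + 1) * p)) := fun j => by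
    rw [mem_traceFiltration_iff, hyval]
    refine Fin.cases ?_ (Fin.cases ?_ (Fin.cases ?_ (fun l => l.elim0))) j
    · rw [hcov0]; exact QhAbs.qha_cover_zero_mem (fun i => algebraMap (MvPolynomial (Fin 4) k) (Localization.Away hh) (X ((![0, 1, 2] : Fin 3 → Fin 4) i))) (![m + 2, 1, m + 1] : Fin 3 → ℕ) _ _ hd₀
    · change cov 1 ∈ _; rw [hcov1]; exact QhAbs.qha_cover_one_mem (fun i => algebraMap (MvPolynomial (Fin 4) k) (Localization.Away hh) (X ((![0, 1, 2] : Fin 3 → Fin 4) i))) (![m + 2, 1, m + 1] : Fin 3 → ℕ) (m + 1) hw0 (p := p) _ _ hd₁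
    · change cov 2 ∈ _; rw [hcov2]; exact QhAbs.qha_cover_two_mem (sigmaAway σ hσh) (fun i => algebraMap (MvPolynomial (Fin 4) k) (Localization.Away hh) (X ((![0, 1, 2] : Fin 3 → Fin 4) i))) (algebraMap (MvPolynomial (Fin 4) k) (Localization.Away hh) (X 2 - X 1 ^ (m + 1) * Polynomial.aeval (X 1 : MvPolynomial (Fin 4) k) wl : MvPolynomial (Fin 4) k)) (![m + 2, 1, m + 1] : Fin 3 → ℕ) (m + 1) ht hσJ (p := p) _ _ hd₂
  have hσy : ∀ j, (sigmaAway σ hσh) (y j : (Localization.Away hh)) = y j := fun j => by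
    rw [hyval]
    refine Fin.cases ?_ (Fin.cases ?_ (Fin.cases ?_ (fun l => l.elim0))) j
    · rw [hcov0]; exact QhAbs.qha_cover_zero_fixed (sigmaAway σ hσh) (fun i => algebraMap (MvPolynomial (Fin 4) k) (Localization.Away hh) (X ((![0, 1, 2] : Fin 3 → Fin 4) i))) r0 _
    · change (sigmaAway σ hσh) (cov 1) = cov 1; rw [hcov1]; exact QhAbs.qha_cover_one_fixed (sigmaAway σ hσh) (fun i => algebraMap (MvPolynomial (Fin 4) k) (Localization.Away hh) (X ((![0, 1, 2] : Fin 3 → Fin 4) i))) r0 r1 hp1 _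
    · change (sigmaAway σ hσh) (cov 2) = cov 2; rw [hcov2]; exact QhAbs.qha_cover_two_fixed (sigmaAway σ hσh) (algebraMap (MvPolynomial (Fin 4) k) (Localization.Away hh) (X 2 - X 1 ^ (m + 1) * Polynomial.aeval (X 1 : MvPolynomial (Fin 4) k) wl : MvPolynomial (Fin 4) k)) hσpL _
  have hc0 := QhAbs.qha_coverElement_zero_eq (fun i => algebraMap (MvPolynomial (Fin 4) k) (Localization.Away hh) (X ((![0, 1, 2] : Fin 3 → Fin 4) i))) (![m + 2, 1, m + 1] : Fin 3 → ℕ) mo 𝒜 (y 0) (hy 0) ((m + 1) * p * D) hd₀ (by rw [hyval, hcov0])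
  have hc1 := QhAbs.qha_coverElement_one_eq (fun i => algebraMap (MvPolynomial (Fin 4) k) (Localization.Away hh) (X ((![0, 1, 2] : Fin 3 → Fin 4) i))) (![m + 2, 1, m + 1] : Fin 3 → ℕ) (m + 1) hw0 mo 𝒜 (y 1) (hy 1) ((m + 2) * (m + 1) * D) hd₁ (by rw [hyval, hcov1])
  have hc2 := QhAbs.qha_coverElement_two_eq (sigmaAway σ hσh) (fun i => algebraMap (MvPolynomial (Fin 4) k) (Localization.Away hh) (X ((![0, 1, 2] : Fin 3 → Fin 4) i))) (algebraMap (MvPolynomial (Fin 4) k) (Localization.Away hh) (X 2 - X 1 ^ (m + 1) * Polynomial.aeval (X 1 : MvPolynomial (Fin 4) k) wl : MvPolynomial (Fin 4) k)) (![m + 2, 1, m + 1] : Fin 3 → ℕ) (m + 1) ht hσJ mo 𝒜 (y 2) (hy 2) hp hσpL ((m + 2) * D) hd₂ (by rw [hyval, hcov2])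
  have hdvd := QhAbs.qha_tail_dvd_coverElement_two (sigmaAway σ hσh) (fun i => algebraMap (MvPolynomial (Fin 4) k) (Localization.Away hh) (X ((![0, 1, 2] : Fin 3 → Fin 4) i))) (algebraMap (MvPolynomial (Fin 4) k) (Localization.Away hh) (X 2 - X 1 ^ (m + 1) * Polynomial.aeval (X 1 : MvPolynomial (Fin 4) k) wl : MvPolynomial (Fin 4) k)) (![m + 2, 1, m + 1] : Fin 3 → ℕ) (m + 1) ht hσJ mo 𝒜 (y 2) (hy 2) hp hσpL ((m + 2) * D) hn₂ hd₂ (by rw [hyval, hcov2])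
  have hrad : ∀ l : Fin 3, cobordantAlgebra.u' (fun i => algebraMap (MvPolynomial (Fin 4) k) (Localization.Away hh) (X ((![0, 1, 2] : Fin 3 → Fin 4) i))) (![m + 2, 1, m + 1] : Fin 3 → ℕ) l ∈ (Ideal.span (Set.range fun j => coverElement 𝒜 (fun i => algebraMap (MvPolynomial (Fin 4) k) (Localization.Away hh) (X ((![0, 1, 2] : Fin 3 → Fin 4) i))) (![m + 2, 1, m + 1] : Fin 3 → ℕ) (D * ((m + 2) * (m + 1) * p)) (y j) (hy j))).radical := fun l =>
    QhAbs.qha_hrad (fun i => algebraMap (MvPolynomial (Fin 4) k) (Localization.Away hh) (X ((![0, 1, 2] : Fin 3 → Fin 4) i))) (![m + 2, 1, m + 1] : Fin 3 → ℕ) (m + 1) (fun j => coverElement 𝒜 (fun i => algebraMap (MvPolynomial (Fin 4) k) (Localization.Away hh) (X ((![0, 1, 2] : Fin 3 → Fin 4) i))) (![m + 2, 1, m + 1] : Fin 3 → ℕ) (D * ((m + 2) * (m + 1) * p)) (y j) (hy j)) hn₁ hc0 hc1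
      (fun j : ZMod p => ((sigmaR (sigmaAway σ hσh) (fun i => algebraMap (MvPolynomial (Fin 4) k) (Localization.Away hh) (X ((![0, 1, 2] : Fin 3 → Fin 4) i))) (![m + 2, 1, m + 1] : Fin 3 → ℕ) hσJ hp hσpL))^[j.val] (⟨_, C_mul_T_mem_cobordantAlgebra _ _ ht⟩ : ↥(cobordantAlgebra (fun i => algebraMap (MvPolynomial (Fin 4) k) (Localization.Away hh) (X ((![0, 1, 2] : Fin 3 → Fin 4) i))) (![m + 2, 1, m + 1] : Fin 3 → ℕ)))) (fun j => graphRoot_iterate_tail_sub_mem σ h0 h1 h2 m wl h3 hh hσh hp hσpL hσJ ht j.val) hc2 l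
  -- the residual ideal `𝔞 ∋ u₀′, t̂, c₂`
  have hmem0 := qhl_u'_zero_mem_residual σ h1 (![m + 2, 1, m + 1] : Fin 3 → ℕ) (m + 1) hw0 hh hσh hp hσp hσJ
  have hmemt := qhl_tail_mem_residual σ (X 2 - X 1 ^ (m + 1) * Polynomial.aeval (X 1 : MvPolynomial (Fin 4) k) wl : MvPolynomial (Fin 4) k) h3 (![m + 2, 1, m + 1] : Fin 3 → ℕ) (m + 1) hh hσh hp hσp hσJ ht
  have hmem2 : coverElement 𝒜 (fun i => algebraMap (MvPolynomial (Fin 4) k) (Localization.Away hh) (X ((![0, 1, 2] : Fin 3 → Fin 4) i))) (![m + 2, 1, m + 1] : Fin 3 → ℕ) (D * ((m + 2) * (m + 1) * p)) (y 2) (hy 2) ∈ ((augmentationIdeal (sigmaR (sigmaAway σ hσh) (fun i => algebraMap (MvPolynomial (Fin 4) k) (Localization.Away hh) (X ((![0, 1, 2] : Fin 3 → Fin 4) i))) (![m + 2, 1, m + 1] : Fin 3 → ℕ) hσJ hp hσpL)).colon (Ideal.span {cobordantAlgebra.s (fun i => algebraMap (MvPolynomial (Fin 4) k) (Localization.Away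 hh) (X ((![0, 1, 2] : Fin 3 → Fin 4) i))) (![m + 2, 1, m + 1] : Fin 3 → ℕ) ^ (m + 1)})) := Ideal.mem_of_dvd _ hdvd hmemt
  refine ⟨y, hy, hσy, hcov0, hcov1, hcov2, hc0, hc1, hdvd, hrad, fun j => ⟨?_, ?_⟩⟩
  · exact QhAbs.qha_residualSection_zero (fun i => algebraMap (MvPolynomial (Fin 4) k) (Localization.Away hh) (X ((![0, 1, 2] : Fin 3 → Fin 4) i))) (![m + 2, 1, m + 1] : Fin 3 → ℕ) mo 𝒜 (fun _ => h𝒜 _) (y j) (hy j) ((m + 1) * p * D) hd₀ _ hmem0 hn₀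
  · exact QhAbs.qha_residualSection_of_mem (fun i => algebraMap (MvPolynomial (Fin 4) k) (Localization.Away hh) (X ((![0, 1, 2] : Fin 3 → Fin 4) i))) (![m + 2, 1, m + 1] : Fin 3 → ℕ) mo 𝒜 (fun _ => h𝒜 _) (y j) (hy j) (y 2) (hy 2) _ hmem2

end Data

end Summit.ResolutionOfSingularities.ResolutionOfSingularities.Theorems.WildQuotientResolution.S1.KillCert.QhAway

end
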